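import Mathlib

/-!
# V3U chart a, parity: the even subring `k[ρ², ρβ, β², passengers]` is the degree-`0` part of the `ℤ/2`-grading by `deg_ρ + deg_β`

(crux stmt-ResolutionOfSingularities-15640 `WildQuotients.WildQuotientResolution`, line `Sketch`,
sector `|G| = p`; programme V3U «toric exit» of `L/w45c/CHAIN.md` v5 §4 row stub-1, step (i) of
C2 `chartA_fixedPoints_eq` (res-L1-w45c-stub-1 plan 2026-08-27T02:17Z); [OURS · L1 W4.5c] — NOT a
statement of any manuscript; replaces the role of no printed item. Route-independent: `import Mathlib` only.)

Let `w : Fin n → ZMod 2` be the PARITY WEIGHT: `w a = w b = 1`, `w i = 0` otherwise (kept abstract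
through the hypotheses `hwa hwb hw0`, so that no definition is needed). A polynomial
`f ∈ k[x₀,…,x_{n-1}]` is `w`-homogeneous of degree `0` (`MvPolynomial.IsWeightedHomogeneous w f 0`)
iff every monomial of `f` has even total degree in `(x_a, x_b)`; we prove
(`mem_adjoin_even_iff`) that this is EXACTLY membership in the even subring
`Algebra.adjoin k ({x_a², x_a x_b, x_b²} ∪ {xᵢ : i ≠ a, b})` (= `ToricExit.chartAGens k n a b` of
`…ToricExitRootChartEven`, written out literally here): `⊆` by `Algebra.adjoin_induction`
(generators are even, even · even = even); `⊇` monomial by monomial (`x_a^i x_b^j` with `i + j`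
even is `(x_a²)^s (x_b²)^t` or `(x_a²)^s (x_b²)^t (x_a x_b)`). This is the `μ₂`-invariance
bookkeeping of the root chart `x_a = ρ²`, `x_b = ρβ`, `r = β²` of `Bl_{(x_a, x_b²)} 𝔸ⁿ`.
-/

-- single-problem summit: the doubled namespace component `ResolutionOfSingularities` is forced
set_option linter.dupNamespace false

noncomputable section

open MvPolynomial

namespace Summit.ResolutionOfSingularities.ResolutionOfSingularities.Theorems.WildQuotientResolution.ToricExit

variable (k : Type) [Field k] (n : ℕ) (a b : Fin n) (hab : a ≠ b) (w : Fin n → ZMod 2)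
  (hwa : w a = 1) (hwb : w b = 1) (hw0 : ∀ i, i ≠ a → i ≠ b → w i = 0)

/-- In `ZMod 2`, `1 + 1 = 0`. [folklore] -/
theorem one_add_one_zmod_two : (1 : ZMod 2) + 1 = 0 := by decide

include hwa hwb hw0 in
/-- **Generators are even**: every element of `{x_a², x_a x_b, x_b²} ∪ {xᵢ : i ≠ a, b}` is
`w`-homogeneous of degree `0`. [folklore] -/
theorem isWeightedHomogeneous_of_mem_gens (g : MvPolynomial (Fin n) k)
    (hg : g ∈ ({X a ^ 2, X a * X b, X b ^ 2} : Set (MvPolynomial (Fin n) k)) ∪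
      ((fun i => X i) '' {i | i ≠ a ∧ i ≠ b})) :
    IsWeightedHomogeneous w g 0 := by
  have hXa : IsWeightedHomogeneous w (X a : MvPolynomial (Fin n) k) 1 := by
    have h := isWeightedHomogeneous_X k w a
    rwa [hwa] at h
  have hXb : IsWeightedHomogeneous w (X b : MvPolynomial (Fin n) k) 1 := by
    have h := isWeightedHomogeneous_X k w b
    rwa [hwb] at h
  rcases hg with hg | ⟨i, ⟨hia, hib⟩, rfl⟩
  · simp only [Set.mem_insert_iff, Set.mem_singleton_iff] at hg
    rcases hg with rfl | rfl | rfl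
    · have h := hXa.mul hXa
      rwa [← sq, one_add_one_zmod_two] at h
    · have h := hXa.mul hXb
      rwa [one_add_one_zmod_two] at h
    · have h := hXb.mul hXb
      rwa [← sq, one_add_one_zmod_two] at h
  · have h := isWeightedHomogeneous_X k w i
    rwa [hw0 i hia hib] at h

include hwa hwb hw0 in
/-- **`⊆`: elements of the even subring are even.** [folklore] -/
theorem isWeightedHomogeneous_of_mem_adjoin (f : MvPolynomial (Fin n) k)
    (hf : f ∈ Algebra.adjoin k (({X a ^ 2, X a * X b, X b ^ 2} : Set (MvPolynomial (Fin n) k)) ∪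
      ((fun i => X i) '' {i | i ≠ a ∧ i ≠ b}))) :
    IsWeightedHomogeneous w f 0 := by
  induction hf using Algebra.adjoin_induction with
  | mem g hg => exact isWeightedHomogeneous_of_mem_gens k n a b w hwa hwb hw0 g hg
  | algebraMap r => exact isWeightedHomogeneous_C w r
  | add x y _ _ hx hy => exact hx.add hy
  | mul x y _ _ hx hy =>
    have h := hx.mul hy
    rwa [add_zero] at h

include hab hwa hwb hw0 in
/-- The weight of an exponent vector `d` is the parity of `d a + d b`. [folklore] -/
theorem weight_eq (d : Fin n →₀ ℕ) : Finsupp.weight w d = ((d a + d b : ℕ) : ZMod 2) := by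
  rw [Finsupp.weight_apply, Finsupp.sum_fintype _ _ (fun i => by simp),
    Fintype.sum_eq_add a b hab]
  · rw [hwa, hwb, nsmul_eq_mul, nsmul_eq_mul, mul_one, mul_one, Nat.cast_add]
  · rintro i ⟨hia, hib⟩
    rw [hw0 i hia hib, smul_zero]

include hab hwa hwb hw0 in
/-- **Evenness as a parity condition on monomials**: `f` is `w`-homogeneous of degree `0` iff every
monomial of `f` has even total degree in `(x_a, x_b)`. [folklore] -/
theorem isWeightedHomogeneous_zero_iff (f : MvPolynomial (Fin n) k) :
    IsWeightedHomogeneous w f 0 ↔ ∀ d ∈ f.support, Even (d a + d b) := by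
  constructor
  · intro hf d hd
    have h := hf (mem_support_iff.mp hd)
    rw [weight_eq n a b hab w hwa hwb hw0] at h
    exact (ZMod.natCast_eq_zero_iff_even).mp h
  · intro h d hd
    rw [weight_eq n a b hab w hwa hwb hw0]
    exact (ZMod.natCast_eq_zero_iff_even).mpr (h d (mem_support_iff.mpr hd))

/-- `x_a^i x_b^j` with `i + j` even lies in the even subring
(`(x_a²)^s (x_b²)^t` or `(x_a²)^s (x_b²)^t (x_a x_b)`). [folklore] -/
theorem pow_mul_pow_mem_adjoin (i j : ℕ) (h : Even (i + j)) :
    (X a ^ i * X b ^ j : MvPolynomial (Fin n) k) ∈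
      Algebra.adjoin k (({X a ^ 2, X a * X b, X b ^ 2} : Set (MvPolynomial (Fin n) k)) ∪
        ((fun i => X i) '' {i | i ≠ a ∧ i ≠ b})) := by
  set E := Algebra.adjoin k (({X a ^ 2, X a * X b, X b ^ 2} : Set (MvPolynomial (Fin n) k)) ∪
    ((fun i => X i) '' {i | i ≠ a ∧ i ≠ b})) with hE
  have h2a : (X a ^ 2 : MvPolynomial (Fin n) k) ∈ E := Algebra.subset_adjoin (Or.inl (by simp))
  have hab' : (X a * X b : MvPolynomial (Fin n) k) ∈ E := Algebra.subset_adjoin (Or.inl (by simp))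
  have h2b : (X b ^ 2 : MvPolynomial (Fin n) k) ∈ E := Algebra.subset_adjoin (Or.inl (by simp))
  rcases Nat.even_or_odd i with ⟨s, hs⟩ | ⟨s, hs⟩
  · have hj : Even j := (Nat.even_add.mp h).mp ⟨s, hs⟩
    obtain ⟨t, ht⟩ := hj
    have e : (X a ^ i * X b ^ j : MvPolynomial (Fin n) k) = (X a ^ 2) ^ s * (X b ^ 2) ^ t := by
      rw [hs, ht]; ring
    rw [e]
    exact E.mul_mem (E.pow_mem h2a s) (E.pow_mem h2b t)
  · have hj : Odd j := by
      rcases Nat.even_or_odd j with hj | hj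
      · exact absurd ((Nat.even_add.mp h).mpr hj) (Nat.not_even_iff_odd.mpr ⟨s, hs⟩)
      · exact hj
    obtain ⟨t, ht⟩ := hj
    have e : (X a ^ i * X b ^ j : MvPolynomial (Fin n) k) =
        (X a ^ 2) ^ s * (X b ^ 2) ^ t * (X a * X b) := by
      rw [hs, ht]; ring
    rw [e]
    exact E.mul_mem (E.mul_mem (E.pow_mem h2a s) (E.pow_mem h2b t)) hab'

include hab hwa hwb hw0 in
/-- **`⊇`: even polynomials lie in the even subring** (monomial by monomial). [folklore] -/
theorem mem_adjoin_of_isWeightedHomogeneous (f : MvPolynomial (Fin n) k)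
    (hf : IsWeightedHomogeneous w f 0) :
    f ∈ Algebra.adjoin k (({X a ^ 2, X a * X b, X b ^ 2} : Set (MvPolynomial (Fin n) k)) ∪
      ((fun i => X i) '' {i | i ≠ a ∧ i ≠ b})) := by
  classical
  set E := Algebra.adjoin k (({X a ^ 2, X a * X b, X b ^ 2} : Set (MvPolynomial (Fin n) k)) ∪
    ((fun i => X i) '' {i | i ≠ a ∧ i ≠ b})) with hE
  have heven := (isWeightedHomogeneous_zero_iff k n a b hab w hwa hwb hw0 f).mp hf
  rw [f.as_sum]
  refine Subalgebra.sum_mem _ fun d hd => ?_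
  rw [monomial_eq, Finsupp.prod_fintype _ _ (fun i => pow_zero _)]
  refine E.mul_mem (E.algebraMap_mem (coeff d f)) ?_
  rw [← Finset.mul_prod_erase _ _ (Finset.mem_univ a),
    ← Finset.mul_prod_erase _ _ (Finset.mem_erase.mpr ⟨hab.symm, Finset.mem_univ b⟩), ← mul_assoc]
  refine E.mul_mem (pow_mul_pow_mem_adjoin k n a b _ _ (heven d hd)) (Subalgebra.prod_mem _ ?_)
  intro i hi
  obtain ⟨hib, hia'⟩ := Finset.mem_erase.mp hi
  obtain ⟨hia, -⟩ := Finset.mem_erase.mp hia'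
  exact E.pow_mem (Algebra.subset_adjoin (Or.inr ⟨i, ⟨hia, hib⟩, rfl⟩)) _

include hab hwa hwb hw0 in
/-- **The even subring is the degree-`0` part of the parity grading.** [folklore] -/
theorem mem_adjoin_even_iff (f : MvPolynomial (Fin n) k) :
    f ∈ Algebra.adjoin k (({X a ^ 2, X a * X b, X b ^ 2} : Set (MvPolynomial (Fin n) k)) ∪
      ((fun i => X i) '' {i | i ≠ a ∧ i ≠ b})) ↔ IsWeightedHomogeneous w f 0 :=
  ⟨isWeightedHomogeneous_of_mem_adjoin k n a b w hwa hwb hw0 f,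
    mem_adjoin_of_isWeightedHomogeneous k n a b hab w hwa hwb hw0 f⟩

/-- **Components**: for the parity weight, every `f` splits as even part + odd part,
`f = weightedHomogeneousComponent w 0 f + weightedHomogeneousComponent w 1 f`. [folklore] -/
theorem eq_add_weightedHomogeneousComponent (f : MvPolynomial (Fin n) k) :
    f = weightedHomogeneousComponent w 0 f + weightedHomogeneousComponent w 1 f := by
  conv_lhs => rw [← sum_weightedHomogeneousComponent w f]
  rw [finsum_eq_sum_of_fintype]
  have huniv : (Finset.univ : Finset (ZMod 2)) = {0, 1} := by decide
  rw [huniv, Finset.sum_pair (by decide)]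

/-- An element that is both even and odd is `0`. [folklore] -/
theorem eq_zero_of_isWeightedHomogeneous_zero_one (f : MvPolynomial (Fin n) k)
    (h0 : IsWeightedHomogeneous w f 0) (h1 : IsWeightedHomogeneous w f 1) : f = 0 := by
  by_contra hf
  exact absurd (h0.inj_right hf h1) (by decide)

end Summit.ResolutionOfSingularities.ResolutionOfSingularities.Theorems.WildQuotientResolution.ToricExit

end
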